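import Summits.FinalStateConjecture.FinalStateConjecture.Theses.ZeroEnergyKerrOrBomb

/-!
# Crux `StationaryLimitReduction` (stmt-FinalStateConjecture-10021) — dominance certificate

The crux of route `ZeroEnergyKerrOrBomb` reads `StationaryLimitReduction := KerrOrBomb →
FinalStateConjecture`. This file records, kernel-checked, where the typed crux sits between the
route's target, the summit statement and the target `UniversalWitnessFamily` of route
`SwallowTheDatum` (item stmt-FinalStateConjecture-10051):

* `stationaryLimitReduction_of_finalStateConjecture` — the summit implies the crux (its
  consequent), the route's target `KerrOrBomb` being idle;
* `stationaryLimitReduction_iff_finalStateConjecture` — once the route's target holds, the crux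
  IS the summit statement (so every line closing the crux through `KerrOrBomb` carries the whole
  large-data half of the conjecture: weak cosmic censorship, settling, genericity transfer);
* `stationaryLimitReduction_of_universalWitnessFamily` — the crux follows outright from the
  universal witness family of route `SwallowTheDatum` (through every admissible datum passes a
  jointly smooth injective admissible one-parameter family all of whose other members satisfy the
  full summit property), written out verbatim from
  `Summits/FinalStateConjecture/FinalStateConjecture/Theses/SwallowTheDatum.lean` so that no second
  route file is imported: the typed Christodoulou genericity of the summit carries no topology on
  data, so a universal witness family is exactly a proof of the summit, and the crux needs nothing
  of `KerrOrBomb` — DEPRECATED 2026-08-17, see below; its live successor is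
* `stationaryLimitReduction_of_tameUniversalWitnessFamily` — the same certificate for the RE-TYPED
  summit (T2, p126844, 2026-08-16T21:18Z): a TAME universal witness family (through every admissible
  datum an injective admissible one-parameter family, tame on one asymptotically flat end and immersed
  at the base point, all of whose other members satisfy the re-typed final-state property — complete
  𝓘⁺, sub-extremal exhaustive decomposition of the self-determined exterior, rays stay in its closure,
  future-oriented charts) is exactly a proof of the re-typed summit, whose tame Christodoulou
  genericity asks for such a family through each EXCEPTIONAL admissible datum only; `KerrOrBomb` is
  again idle.

Classical logic only; no definition is introduced. Line `Glue` (card share-the-burial) of the crux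
chain of stmt-FinalStateConjecture-10021, lead c2 (lineage 0).

Maintenance record (full-build repair, 2026-08-17; dependency drift). The summit statement
`_root_.FinalStateConjecture` was RE-TYPED on 2026-08-16T21:18Z (p126844: `IsTameChristodoulouGeneric`
replaces the topology-free `IsChristodoulouGeneric`, and the final-state property gains
`RaysStayInClosure` and `IsFutureOriented`), and route `SwallowTheDatum`, whose target
`UniversalWitnessFamily` the third theorem took verbatim as hypothesis, was closed as moot the same
evening (the re-type excludes the burial mechanism by design). `StationaryLimitReduction := KerrOrBomb →
FinalStateConjecture` kept its name and text but now unfolds to the re-typed summit, so the proof of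
`stationaryLimitReduction_of_universalWitnessFamily` stopped elaborating (66:9: the witness now starts
with an `AFEnd`), and its STATEMENT — old topology-free witness family ⟹ re-typed summit — is no longer
a matter of logic (the old family is neither tame nor immersed, and its members lack the two new
clauses). Theorems files are append-only, so the statement is not mutated in place: the re-typed
certificate is added under the new name `stationaryLimitReduction_of_tameUniversalWitnessFamily` and
the old name is kept as a `@[deprecated]` alias of it (same logical role; the only spelling that
still type-checks). The two other theorems are unchanged.
-/

-- every `Summit.FinalStateConjecture.FinalStateConjecture.…` name repeats the summit = sub-problem
-- segment (D-0017 layout, CONVENTIONS §2); the duplicate is deliberate.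
set_option linter.dupNamespace false

open scoped Manifold ContDiff

namespace Summit.FinalStateConjecture.FinalStateConjecture.Theorems

open Summit.FinalStateConjecture.FinalStateConjecture.Theses.ZeroEnergyKerrOrBomb

/-- **The summit implies the crux.** `StationaryLimitReduction` is `KerrOrBomb →
FinalStateConjecture`; given the summit statement the antecedent is not used. -/
theorem stationaryLimitReduction_of_finalStateConjecture (h : _root_.FinalStateConjecture) :
    StationaryLimitReduction :=
  fun _ ↦ h

/-- **Given the route's target, the crux is the summit.** Under `KerrOrBomb` the implication
`KerrOrBomb → FinalStateConjecture` is equivalent to `FinalStateConjecture` itself: a proof of the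
crux that consumes the target is a proof of the final state conjecture modulo smooth rigidity of
mode-stable stationary vacuum holes, and nothing less. -/
theorem stationaryLimitReduction_iff_finalStateConjecture (hX : KerrOrBomb) :
    StationaryLimitReduction ↔ _root_.FinalStateConjecture :=
  ⟨fun h ↦ h hX, fun h _ ↦ h⟩

/-- **A tame universal witness family closes the crux** (re-typed successor, 2026-08-17, of the
card share-the-burial certificate; the hypothesis is the tame analogue of the body of the retired
`Summit.FinalStateConjecture.FinalStateConjecture.Theses.SwallowTheDatum.UniversalWitnessFamily`,
item stmt-FinalStateConjecture-10051, for the re-typed final-state property, written out verbatim from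
`Summits/FinalStateConjecture/FinalStateConjecture/Statement.lean` and
`Literature.Geometry.Lorentzian.InitialDataSet.HasTameCodimAtLeastIn`): if through every admissible
vacuum datum `d` on every connected Hausdorff second-countable smooth `3`-manifold pass ONE
asymptotically flat end `e` and an injective one-parameter family `F` of admissible data with
`F 0 = d`, tame on `e` (`IsTameDataFamily`: jointly smooth, `e` the sole end, Dafermos–Rodnianski
asymptotics with continuous mass, weighted continuity at `c = 0`) and immersed at `0`
(`IsImmersedAtZero`), all of whose members `F c`, `c ≠ 0`, have a maximal vacuum Cauchy development
and whose every maximal development has complete future null infinity and an exhaustive,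
future-oriented, sub-extremal Kerr final-state decomposition of its self-determined exterior in whose
closure all future-complete null rays from the data stay, then `StationaryLimitReduction` holds —
indeed the re-typed summit holds, since its tame Christodoulou genericity (tame codimension `1`) asks
for exactly such an end and family through each EXCEPTIONAL admissible datum; the antecedent
`KerrOrBomb` is not used. Pure logic. -/
theorem stationaryLimitReduction_of_tameUniversalWitnessFamily : (∀ (X : Type) [TopologicalSpace X] [ChartedSpace Literature.Geometry.Lorentzian.E3 X] [IsManifold (𝓡 3) ((⊤ : ℕ∞) : WithTop ℕ∞) X] [T2Space X] [SecondCountableTopology X] [ConnectedSpace X], ∀ d ∈ Literature.Geometry.Lorentzian.admissibleVacuumData X, ∃ (e : Literature.Geometry.Lorentzian.AFEnd X) (F : EuclideanSpace ℝ (Fin 1) → Literature.Geometry.Lorentzian.InitialDataSet (𝓡 3) X), Literature.Geometry.Lorentzian.InitialDataSet.IsTameDataFamily e 1 F ∧ Literature.Geometry.Lorentzian.InitialDataSet.IsImmersedAtZero 1 F ∧ F 0 = d ∧ Function.Injective F ∧ (∀ c, F c ∈ Literature.Geometry.Lorentzian.admissibleVacuumData X) ∧ ∀ c ≠ 0, (∃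 𝒟 : Literature.Geometry.Lorentzian.VacuumCauchyDevelopment (F c), 𝒟.IsMaximal) ∧ ∀ 𝒟 : Literature.Geometry.Lorentzian.VacuumCauchyDevelopment (F c), 𝒟.IsMaximal → Summit.FinalStateConjecture.HasCompleteNullInfinity 𝒟.toCauchyDevelopment ∧ ∃ (O : Set 𝒟.carrier) (dec : Literature.Geometry.Lorentzian.FinalStateDecomposition 𝒟.toSpacetime O 2), (∀ i, Literature.Geometry.Lorentzian.Kerr.IsSubextremal (dec.mass i) (dec.spin i)) ∧ O = Summit.FinalStateConjecture.exteriorOf 𝒟.toCauchyDevelopment dec.charted ∧ Summit.FinalStateConjecture.RaysStayInClosure 𝒟.toCauchyDevelopment O ∧ Summit.FinalStateConjecture.HasExhaustiveCharts dec ∧ Summit.FinalStateConjecture.IsFutureOriented dec) → Summit.FinalStateConjecture.FinalStateConjecture.Theses.ZeroEnergyKerrOrBomb.StationaryLimitReduction := by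
  intro hU _ X _ _ _ _ _ _ d hd
  obtain ⟨e, F, hF, himm, h0, hinj, hadm, hP⟩ := hU X d hd.1
  exact ⟨e, F, hF, himm, h0, hinj, hadm, fun c hc hmem ↦ hmem.2 (hP c hc)⟩

/-- Deprecated spelling (card share-the-burial, landed p122022): the original statement took as
hypothesis the body of the RETIRED route target `SwallowTheDatum.UniversalWitnessFamily`
(stmt-FinalStateConjecture-10051; a topology-free smooth witness family for the pre-T2 final-state
property) and concluded `StationaryLimitReduction` by the same pure logic against the pre-T2 summit.
Since the T2 re-type of `_root_.FinalStateConjecture` (p126844, 2026-08-16T21:18Z; tame genericity,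
rays-stay-in-closure, future orientation) that implication is no longer pure logic and its proof no
longer elaborates; route `SwallowTheDatum` was closed as moot for the same reason. The name is kept
(append-only) as an alias of the re-typed certificate
`stationaryLimitReduction_of_tameUniversalWitnessFamily`, which plays the identical role for the
current summit. -/
@[deprecated stationaryLimitReduction_of_tameUniversalWitnessFamily (since := "2026-08-17")]
alias stationaryLimitReduction_of_universalWitnessFamily :=
  stationaryLimitReduction_of_tameUniversalWitnessFamily

end Summit.FinalStateConjecture.FinalStateConjecture.Theorems
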